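import Summits.AtomisticToContinuum.Crystallization.Theorems.ThreeConeCertificateSlackRigidityPricedFloorsDefs
import HarnessLib

/-!
# `SlackRigidity` (stmt-AtomisticToContinuum-11960), line `priced-floors-palm-exactification`, stub S3
# (`stub_layeredMeanSelection`): abstract probabilistic lemmas of the selection-in-mean argument

Lead c19, S3 probabilistic core, part 2 (pure measure theory on a probability space of
configurations; no geometry).

* `integral_ge_of_transport` — FROM A TRANSPORT IDENTITY TO A MEAN LOWER BOUND: if a bounded
  measurable functional `G` satisfies the transport identity
  `∫⁻ ofReal(G + M) dP = ∫⁻ (∫⁻ Ωs μ y · ofReal(G(θ_y μ) + M) dμ) dP` (an instance of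
  `lms_lintegral_eq_transport`) and the transported quantity is pointwise `≥ ofReal(b + M)` (a
  DETERMINISTIC window bound at each sample), then `b ≤ ∫ G dP`.  No measurability of the re-rooted
  integrand is needed.
* `ae_eq_zero_of_price` — THE PRICING CONCLUSION: if `0 ≤ F ≤ K`, `c F ≤ H − Hc` a.e. with `c > 0`,
  `∫ H ≤ e` and `e ≤ ∫ Hc` (all bounded measurable), then `F = 0` a.e.

Registered sub-goal `lms_ae_eq_zero_of_price`.  All `[folklore]`.
-/

noncomputable section

open MeasureTheory Filter Set
open scoped ENNReal BigOperators Topology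

namespace Summit.AtomisticToContinuum.Crystallization.Theorems.SlackRigidityPricedFloorsProb

open Summit.AtomisticToContinuum.Crystallization.Theorems.SlackRigidityPricedFloors

variable {P : Measure (Measure E3)}

/-- A bounded (a.e.) measurable real functional on a probability space is integrable. [folklore] -/
theorem integrable_of_abs_le [IsProbabilityMeasure P] {G : Measure E3 → ℝ} (hG : Measurable G) {M : ℝ}
    (hb : ∀ᵐ μ ∂P, |G μ| ≤ M) : Integrable G P :=
  Integrable.of_bound hG.aestronglyMeasurable M (by simpa [Real.norm_eq_abs] using hb)

/-- **From a transport identity to a mean lower bound.** [folklore] -/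
theorem integral_ge_of_transport [IsProbabilityMeasure P] {G : Measure E3 → ℝ} (hG : Measurable G)
    {M b : ℝ} (hb : ∀ᵐ μ ∂P, |G μ| ≤ M) {Ωs : Measure E3 → E3 → ℝ≥0∞}
    (hT : ∫⁻ μ, ENNReal.ofReal (G μ + M) ∂P =
      ∫⁻ μ, ∫⁻ y, Ωs μ y * ENNReal.ofReal (G (μ.map (fun z => z - y)) + M) ∂μ ∂P)
    (hid : ∀ᵐ μ ∂P, ENNReal.ofReal (b + M) ≤
      ∫⁻ y, Ωs μ y * ENNReal.ofReal (G (μ.map (fun z => z - y)) + M) ∂μ) :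
    b ≤ ∫ μ, G μ ∂P := by
  have hint : Integrable G P := integrable_of_abs_le hG hb
  have hintM : Integrable (fun μ => G μ + M) P := hint.add (integrable_const M)
  have hnn : 0 ≤ᵐ[P] fun μ => G μ + M := by
    filter_upwards [hb] with μ hμ
    have := neg_abs_le (G μ)
    show (0 : ℝ) ≤ G μ + M
    linarith
  -- `ofReal (b + M) ≤ ∫⁻ ofReal (G + M) = ofReal (∫ (G + M))`
  have h1 : ENNReal.ofReal (b + M) ≤ ∫⁻ μ, ENNReal.ofReal (G μ + M) ∂P := by
    calc ENNReal.ofReal (b + M) = ∫⁻ _μ, ENNReal.ofReal (b + M) ∂P := by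
          rw [lintegral_const, measure_univ, mul_one]
      _ ≤ ∫⁻ μ, ∫⁻ y, Ωs μ y * ENNReal.ofReal (G (μ.map (fun z => z - y)) + M) ∂μ ∂P :=
          lintegral_mono_ae hid
      _ = ∫⁻ μ, ENNReal.ofReal (G μ + M) ∂P := hT.symm
  rw [← ofReal_integral_eq_lintegral_ofReal hintM hnn] at h1
  by_cases hbM : b + M ≤ 0
  · -- trivial case: `∫ G ≥ -M ≥ b`
    have : -M ≤ ∫ μ, G μ ∂P := by
      have h2 : ∫ _μ, (-M) ∂P ≤ ∫ μ, G μ ∂P :=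
        integral_mono_ae (integrable_const _) hint (by
          filter_upwards [hb] with μ hμ; linarith [neg_abs_le (G μ)])
      simpa [integral_const, measure_univ] using h2
    linarith
  · push Not at hbM
    have h2 := (ENNReal.ofReal_le_ofReal_iff (integral_nonneg_of_ae hnn)).1 h1
    rw [integral_add hint (integrable_const M), integral_const, smul_eq_mul] at h2
    simp only [probReal_univ, one_mul] at h2
    linarith

/-- **The pricing conclusion** (registered sub-goal `lms_ae_eq_zero_of_price`): a nonnegative bounded
measurable functional `F` priced by `c F ≤ H − Hc` a.e., with `∫ H ≤ e ≤ ∫ Hc`, vanishes almost surely.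
[folklore] -/
theorem lms_ae_eq_zero_of_price : ∀ (P : Measure (Measure E3)), IsProbabilityMeasure P → ∀ (F H Hc : Measure E3 → ℝ), Measurable F → Measurable H → Measurable Hc → ∀ (K c e : ℝ), 0 < c → (∀ᵐ μ ∂P, 0 ≤ F μ ∧ F μ ≤ K) → (∀ᵐ μ ∂P, |H μ| ≤ K) → (∀ᵐ μ ∂P, |Hc μ| ≤ K) → (∀ᵐ μ ∂P, c * F μ ≤ H μ - Hc μ) → (∫ μ, H μ ∂P) ≤ e → e ≤ (∫ μ, Hc μ ∂P) → ∀ᵐ μ ∂P, F μ = 0 := by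
  intro P hP F H Hc hF hH hHc K c e hc hF0 hHb hHcb hprice hHe heHc
  have hFint : Integrable F P := integrable_of_abs_le hF (M := K) (by
    filter_upwards [hF0] with μ hμ; rw [abs_of_nonneg hμ.1]; exact hμ.2)
  have hHint : Integrable H P := integrable_of_abs_le hH hHb
  have hHcint : Integrable Hc P := integrable_of_abs_le hHc hHcb
  -- `c ∫ F ≤ ∫ H − ∫ Hc ≤ 0`
  have h1 : c * ∫ μ, F μ ∂P ≤ (∫ μ, H μ ∂P) - ∫ μ, Hc μ ∂P := by
    rw [← integral_const_mul, ← integral_sub hHint hHcint]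
    exact integral_mono_ae (hFint.const_mul c) (hHint.sub hHcint) hprice
  have h2 : ∫ μ, F μ ∂P ≤ 0 := by
    by_contra h
    push Not at h
    nlinarith
  have h3 : 0 ≤ᵐ[P] F := by
    filter_upwards [hF0] with μ hμ using hμ.1
  have h4 : ∫ μ, F μ ∂P = 0 := le_antisymm h2 (integral_nonneg_of_ae h3)
  have h5 := (integral_eq_zero_iff_of_nonneg_ae h3 hFint).1 h4
  filter_upwards [h5] with μ hμ using hμ

end Summit.AtomisticToContinuum.Crystallization.Theorems.SlackRigidityPricedFloorsProb

end
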